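import Summits.Ventures.CertifiedArithmetic.LowPrec.GemmThetaE5M2Cover
import Summits.Ventures.CertifiedArithmetic.LowPrec.GemmFreeMoves
import Summits.Ventures.CertifiedArithmetic.LowPrec.GemmThetaE5M2Check01
import Summits.Ventures.CertifiedArithmetic.LowPrec.GemmThetaE5M2Check02
import Summits.Ventures.CertifiedArithmetic.LowPrec.GemmThetaE5M2Check03
import Summits.Ventures.CertifiedArithmetic.LowPrec.GemmThetaE5M2Check04
import Summits.Ventures.CertifiedArithmetic.LowPrec.GemmThetaE5M2Check05
import Summits.Ventures.CertifiedArithmetic.LowPrec.GemmThetaE5M2Check06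
import Summits.Ventures.CertifiedArithmetic.LowPrec.GemmThetaE5M2Check07
import Summits.Ventures.CertifiedArithmetic.LowPrec.GemmThetaE5M2Check08
import Summits.Ventures.CertifiedArithmetic.LowPrec.GemmThetaE5M2Check09
import Summits.Ventures.CertifiedArithmetic.LowPrec.GemmThetaE5M2Check10
import Summits.Ventures.CertifiedArithmetic.LowPrec.GemmThetaE5M2Check11
import Summits.Ventures.CertifiedArithmetic.LowPrec.GemmThetaE5M2Check12
import Summits.Ventures.CertifiedArithmetic.LowPrec.GemmThetaE5M2Check13
import Summits.Ventures.CertifiedArithmetic.LowPrec.GemmThetaE5M2Check14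
import Summits.Ventures.CertifiedArithmetic.LowPrec.GemmThetaE5M2Check15
import Summits.Ventures.CertifiedArithmetic.LowPrec.GemmThetaE5M2Check16
import Summits.Ventures.CertifiedArithmetic.LowPrec.GemmThetaE5M2Check17
import Summits.Ventures.CertifiedArithmetic.LowPrec.GemmThetaE5M2Check18
import Summits.Ventures.CertifiedArithmetic.LowPrec.GemmThetaE5M2Check19
import Summits.Ventures.CertifiedArithmetic.LowPrec.GemmThetaE5M2Check20
import Summits.Ventures.CertifiedArithmetic.LowPrec.GemmThetaE5M2Check21
import Summits.Ventures.CertifiedArithmetic.LowPrec.GemmThetaE5M2Check22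
import Summits.Ventures.CertifiedArithmetic.LowPrec.GemmThetaE5M2Check23
import Summits.Ventures.CertifiedArithmetic.LowPrec.GemmThetaE5M2Check24
import Summits.Ventures.CertifiedArithmetic.LowPrec.GemmThetaE5M2Check25
import Summits.Ventures.CertifiedArithmetic.LowPrec.GemmThetaE5M2Check26
import Summits.Ventures.CertifiedArithmetic.LowPrec.GemmThetaE5M2Check27
import Summits.Ventures.CertifiedArithmetic.LowPrec.GemmThetaE5M2Check28

/-!
# The θ-certificate of E5M2²→bfloat16, assembled: `thetaCert_E5M2_BFloat16`

HONEST FRAMING (venture CertifiedArithmetic / cell `pub-lowprec`, seat gemm, gen 9): certified error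
envelopes and provably optimal rounding/accumulation schemes for low-precision formats under stated
cost models; every table by two implementations; no hardware or vendor claims.

Paper `gemm.tex` §Regimes, Prop. "the terminal constant bounds the defect for every n" (i), instance
OCP FP8 E5M2·E5M2 products ([MicikeviciusEtAl2022, Table 1]) accumulated sequentially in `bfloat16`
(RNE): the kernel-checked chunk theorems of `GemmThetaE5M2Check01..28.lean` cover all `1211`
letters (`cover_all`), so by the soundness of the compressed format (`GemmThetaE5M2Cover.lean`)
every one of the `2 · 8449 · 1211 = 20 463 478` edges of the reachable graph satisfies the `Facts`;
read through the dictionary `v = V/2^32` (bridge `GemmGridRounding120.lean`) they are the fields of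
a `ThetaCertificate` (`GemmThetaCertificate.lean`) with `θ = 439100963668623365/2^55 ≈ 12.1875`,
`ρ = 29/6`, `κ = 1/θ` and the free-pair constant `β_pair = 33/2 = 2 + 3ρ` — the latter DERIVED
(`free_pair_bound` + Lemma D `no_consecutive_free_moves` of `GemmFreeMoves.lean`: the move after a
free move is paid), not read off the cell certificate.  Same assembly as `GemmThetaE4M3.lean`.
-/

namespace Literature.ComputerArithmetic.FloatingPoint

namespace MiniFloat

open Finset ThetaE5M2

namespace ThetaE5M2

/-! ### Every letter is covered -/

/-- ALL `1211` LETTERS ARE COVERED (the chunk theorems, concatenated). [cell certificate,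
kernel-checked] -/
theorem cover_all : CoverRange 0 1211 := by
  have h₁ : CoverRange 0 23 := coverRange_of_chunkOK chunk_0
  have h₂ : CoverRange 0 45 := coverRange_append h₁ (coverRange_of_chunkOK chunk_23) (by norm_num)
  have h₃ : CoverRange 0 68 := coverRange_append h₂ (coverRange_of_chunkOK chunk_45) (by norm_num)
  have h₄ : CoverRange 0 90 := coverRange_append h₃ (coverRange_of_chunkOK chunk_68) (by norm_num)
  have h₅ : CoverRange 0 112 := coverRange_append h₄ (coverRange_of_chunkOK chunk_90) (by norm_num)
  have h₆ : CoverRange 0 133 := coverRange_append h₅ (coverRange_of_chunkOK chunk_112) (by norm_num)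
  have h₇ : CoverRange 0 154 := coverRange_append h₆ (coverRange_of_chunkOK chunk_133) (by norm_num)
  have h₈ : CoverRange 0 174 := coverRange_append h₇ (coverRange_of_chunkOK chunk_154) (by norm_num)
  have h₉ : CoverRange 0 197 := coverRange_append h₈ (coverRange_of_chunkOK chunk_174) (by norm_num)
  have h₁₀ : CoverRange 0 219 := coverRange_append h₉ (coverRange_of_chunkOK chunk_197) (by norm_num)
  have h₁₁ : CoverRange 0 241 := coverRange_append h₁₀ (coverRange_of_chunkOK chunk_219) (by norm_num)
  have h₁₂ : CoverRange 0 263 := coverRange_append h₁₁ (coverRange_of_chunkOK chunk_241) (by norm_num)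
  have h₁₃ : CoverRange 0 284 := coverRange_append h₁₂ (coverRange_of_chunkOK chunk_263) (by norm_num)
  have h₁₄ : CoverRange 0 304 := coverRange_append h₁₃ (coverRange_of_chunkOK chunk_284) (by norm_num)
  have h₁₅ : CoverRange 0 327 := coverRange_append h₁₄ (coverRange_of_chunkOK chunk_304) (by norm_num)
  have h₁₆ : CoverRange 0 349 := coverRange_append h₁₅ (coverRange_of_chunkOK chunk_327) (by norm_num)
  have h₁₇ : CoverRange 0 371 := coverRange_append h₁₆ (coverRange_of_chunkOK chunk_349) (by norm_num)
  have h₁₈ : CoverRange 0 393 := coverRange_append h₁₇ (coverRange_of_chunkOK chunk_371) (by norm_num)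
  have h₁₉ : CoverRange 0 414 := coverRange_append h₁₈ (coverRange_of_chunkOK chunk_393) (by norm_num)
  have h₂₀ : CoverRange 0 434 := coverRange_append h₁₉ (coverRange_of_chunkOK chunk_414) (by norm_num)
  have h₂₁ : CoverRange 0 457 := coverRange_append h₂₀ (coverRange_of_chunkOK chunk_434) (by norm_num)
  have h₂₂ : CoverRange 0 479 := coverRange_append h₂₁ (coverRange_of_chunkOK chunk_457) (by norm_num)
  have h₂₃ : CoverRange 0 501 := coverRange_append h₂₂ (coverRange_of_chunkOK chunk_479) (by norm_num)
  have h₂₄ : CoverRange 0 523 := coverRange_append h₂₃ (coverRange_of_chunkOK chunk_501) (by norm_num)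
  have h₂₅ : CoverRange 0 544 := coverRange_append h₂₄ (coverRange_of_chunkOK chunk_523) (by norm_num)
  have h₂₆ : CoverRange 0 564 := coverRange_append h₂₅ (coverRange_of_chunkOK chunk_544) (by norm_num)
  have h₂₇ : CoverRange 0 587 := coverRange_append h₂₆ (coverRange_of_chunkOK chunk_564) (by norm_num)
  have h₂₈ : CoverRange 0 609 := coverRange_append h₂₇ (coverRange_of_chunkOK chunk_587) (by norm_num)
  have h₂₉ : CoverRange 0 632 := coverRange_append h₂₈ (coverRange_of_chunkOK chunk_609) (by norm_num)
  have h₃₀ : CoverRange 0 655 := coverRange_append h₂₉ (coverRange_of_chunkOK chunk_632) (by norm_num)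
  have h₃₁ : CoverRange 0 676 := coverRange_append h₃₀ (coverRange_of_chunkOK chunk_655) (by norm_num)
  have h₃₂ : CoverRange 0 697 := coverRange_append h₃₁ (coverRange_of_chunkOK chunk_676) (by norm_num)
  have h₃₃ : CoverRange 0 718 := coverRange_append h₃₂ (coverRange_of_chunkOK chunk_697) (by norm_num)
  have h₃₄ : CoverRange 0 738 := coverRange_append h₃₃ (coverRange_of_chunkOK chunk_718) (by norm_num)
  have h₃₅ : CoverRange 0 761 := coverRange_append h₃₄ (coverRange_of_chunkOK chunk_738) (by norm_num)
  have h₃₆ : CoverRange 0 783 := coverRange_append h₃₅ (coverRange_of_chunkOK chunk_761) (by norm_num)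
  have h₃₇ : CoverRange 0 805 := coverRange_append h₃₆ (coverRange_of_chunkOK chunk_783) (by norm_num)
  have h₃₈ : CoverRange 0 827 := coverRange_append h₃₇ (coverRange_of_chunkOK chunk_805) (by norm_num)
  have h₃₉ : CoverRange 0 848 := coverRange_append h₃₈ (coverRange_of_chunkOK chunk_827) (by norm_num)
  have h₄₀ : CoverRange 0 868 := coverRange_append h₃₉ (coverRange_of_chunkOK chunk_848) (by norm_num)
  have h₄₁ : CoverRange 0 891 := coverRange_append h₄₀ (coverRange_of_chunkOK chunk_868) (by norm_num)
  have h₄₂ : CoverRange 0 913 := coverRange_append h₄₁ (coverRange_of_chunkOK chunk_891) (by norm_num)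
  have h₄₃ : CoverRange 0 935 := coverRange_append h₄₂ (coverRange_of_chunkOK chunk_913) (by norm_num)
  have h₄₄ : CoverRange 0 957 := coverRange_append h₄₃ (coverRange_of_chunkOK chunk_935) (by norm_num)
  have h₄₅ : CoverRange 0 978 := coverRange_append h₄₄ (coverRange_of_chunkOK chunk_957) (by norm_num)
  have h₄₆ : CoverRange 0 998 := coverRange_append h₄₅ (coverRange_of_chunkOK chunk_978) (by norm_num)
  have h₄₇ : CoverRange 0 1021 := coverRange_append h₄₆ (coverRange_of_chunkOK chunk_998) (by norm_num)
  have h₄₈ : CoverRange 0 1043 := coverRange_append h₄₇ (coverRange_of_chunkOK chunk_1021) (by norm_num)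
  have h₄₉ : CoverRange 0 1065 := coverRange_append h₄₈ (coverRange_of_chunkOK chunk_1043) (by norm_num)
  have h₅₀ : CoverRange 0 1087 := coverRange_append h₄₉ (coverRange_of_chunkOK chunk_1065) (by norm_num)
  have h₅₁ : CoverRange 0 1108 := coverRange_append h₅₀ (coverRange_of_chunkOK chunk_1087) (by norm_num)
  have h₅₂ : CoverRange 0 1128 := coverRange_append h₅₁ (coverRange_of_chunkOK chunk_1108) (by norm_num)
  have h₅₃ : CoverRange 0 1151 := coverRange_append h₅₂ (coverRange_of_chunkOK chunk_1128) (by norm_num)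
  have h₅₄ : CoverRange 0 1173 := coverRange_append h₅₃ (coverRange_of_chunkOK chunk_1151) (by norm_num)
  have h₅₅ : CoverRange 0 1192 := coverRange_append h₅₄ (coverRange_of_chunkOK chunk_1173) (by norm_num)
  have h₅₆ : CoverRange 0 1211 := coverRange_append h₅₅ (coverRange_of_chunkOK chunk_1192) (by norm_num)
  exact h₅₆

/-- THE FACTS OF EVERY EDGE `(σ, i) → Q` of the reachable graph. [cell certificate, kernel-checked] -/
theorem edge_facts (σ : Bool) {i : ℕ} (hi : i ≤ 8448) {Q : ℤ} (hQ : Q ∈ lamG) : Facts σ i Q :=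
  facts_of_cover hQ (coverOK_of_range cover_all hQ) σ hi

/-! ### The dictionary in grid units `2^-32` -/

/-- The bridge applies to every edge: `|V + Q| < 2^120`. [cell] -/
theorem hb120 (σ : Bool) (i : ℕ) {Q : ℤ} (hQ : Q ∈ lamG) : (sval σ i + Q).natAbs < 2 ^ 120 :=
  natAbs_add_lt120 ((natAbs_sval_le σ i).trans (by norm_num))
    ((natAbs_le_of_mem_lamG hQ).trans (by norm_num))

/-- THE POTENTIAL as a function on `ℚ`: `Φ(v) = psiZ(2^32 v)/2^32`. [cell, gemm.tex §Regimes] -/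
def psiG (v : ℚ) : ℚ := (psiZ ⌊v * 2 ^ 32⌋ : ℚ) / 2 ^ 32

/-- `Φ(V/2^32) = psiZ V / 2^32`. [cell] -/
theorem psiG_dyadic (V : ℤ) : psiG ((V : ℚ) / 2 ^ 32) = (psiZ V : ℚ) / 2 ^ 32 := by
  unfold psiG; rw [div_mul_cancel₀ (V : ℚ) (by norm_num : (2 : ℚ) ^ 32 ≠ 0), Int.floor_intCast]

/-- THE STATE SET: `± valG i / 2^32`, `i ≤ 8448`. [cell, gemm.tex §Regimes] -/
def SG (v : ℚ) : Prop := ∃ σ : Bool, ∃ i : ℕ, i ≤ 8448 ∧ v = (sval σ i : ℚ) / 2 ^ 32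

/-- A recognised magnitude is a state. [cell] -/
theorem SG_of_idx {W : ℤ} (h1 : idxG W.natAbs ≤ 8448) (h2 : valG (idxG W.natAbs) = W.natAbs) :
    SG ((W : ℚ) / 2 ^ 32) := by
  refine ⟨decide (W < 0), idxG W.natAbs, h1, ?_⟩
  have : sval (decide (W < 0)) (idxG W.natAbs) = W := by
    unfold sval; rw [h2]
    by_cases hW : W < 0
    · simp only [hW, decide_true, if_true]; omega
    · simp only [hW, decide_false, Bool.false_eq_true, if_false]; omega
  rw [this]

/-- A state is a `bfloat16` datum. [cell] -/
theorem exists_toRat_eq_sval (σ : Bool) {i : ℕ} (hi : i ≤ 8448) :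
    ∃ y : MiniFloat Format.BFloat16, y.toRat = (sval σ i : ℚ) / 2 ^ 32 := by
  have hb : (sval σ i - ((qlo σ i : ℕ) : ℤ)).natAbs < 2 ^ 120 := by
    have := natAbs_sval_le σ i; have := (qlo_le_qhi_le σ i).1; omega
  obtain ⟨y, hy⟩ := exists_toRat_eq_rne8_dyadic120 g32 _ hb
  exact ⟨y, by rw [hy, sval_eq_rne8 σ hi]⟩

/-- LEMMA D IN GRID UNITS: the move after a free move is paid (`d' > 0`). [cell, GemmFreeMoves] -/
theorem second_move_paid (σ : Bool) {i : ℕ} (hi : i ≤ 8448) {Q Q' : ℤ} (hQ : Q ∈ lamG)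
    (hQ' : Q' ∈ lamG) (hne : WQ σ i Q ≠ sval σ i) (hd0 : defQ σ i Q = 0) {τ : Bool} {j : ℕ}
    (hW : WQ σ i Q = sval τ j) (hne2 : WQ τ j Q' ≠ sval τ j) : 0 < defQ τ j Q' := by
  have h232 : (0 : ℚ) < 2 ^ 32 := by positivity
  obtain ⟨y, hy⟩ := exists_toRat_eq_sval σ hi
  have hb := hb120 σ i hQ
  have hb' := hb120 τ j hQ'
  unfold WQ at hW hne hne2
  have e1 : (roundNE Format.BFloat16 (y.toRat + (Q : ℚ) / 2 ^ 32)).toRat = (sval τ j : ℚ) / 2 ^ 32 := by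
    have := flStep_dyadic120 g32 hb
    unfold flStep at this
    rw [hy, this, hW]
  have e2 : (roundNE Format.BFloat16 ((sval τ j : ℚ) / 2 ^ 32 + (Q' : ℚ) / 2 ^ 32)).toRat
      = (rne8 (sval τ j + Q') : ℚ) / 2 ^ 32 := by
    have := flStep_dyadic120 g32 hb'
    unfold flStep at this
    exact this
  have hm : 1 ≤ Format.BFloat16.manBits := by rw [BFloat16_manBits]; norm_num
  have hδ : sval τ j - (sval σ i + Q) = (Q.natAbs : ℤ) := by
    unfold defQ gainQ WQ at hd0; rw [hW] at hd0; omega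
  have hlt := no_consecutive_free_moves hm y ((Q : ℚ) / 2 ^ 32) ((Q' : ℚ) / 2 ^ 32)
    (by rw [e1, hy]; intro h; exact hne (hW.trans (dyadic_eq_iff.mp h)))
    (by
      rw [e1, hy, abs_div, abs_of_pos h232, ← Int.cast_abs, ← Int.natCast_natAbs, ← add_div,
        ← sub_div, ← hδ]
      push_cast; ring)
    (by rw [e1, e2]; intro h; exact hne2 (dyadic_eq_iff.mp h))
  rw [e1, e2, abs_div, abs_of_pos h232, ← Int.cast_abs, ← Int.natCast_natAbs, ← add_div, ← sub_div,
    div_lt_div_iff_of_pos_right h232] at hlt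
  have h' : rne8 (sval τ j + Q') - (sval τ j + Q') < (Q'.natAbs : ℤ) := by exact_mod_cast hlt
  unfold defQ gainQ WQ
  omega

end ThetaE5M2

/-- THE ALPHABET: the `1211` products `E5M2 · E5M2` as rationals (grid `2^-32`).
[cell, gemm.tex §Regimes; MicikeviciusEtAl2022 Table 1 for the value set] -/
def piE5M2 : List ℚ := lamG.map fun Q : ℤ => (Q : ℚ) / 2 ^ 32

/-- Every letter of `piE5M2` is `Q/2^32` with `Q ∈ lamG`. [cell] -/
theorem exists_of_mem_piE5M2 {q : ℚ} (hq : q ∈ piE5M2) : ∃ Q ∈ lamG, (Q : ℚ) / 2 ^ 32 = q :=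
  List.mem_map.mp hq

/-! ### The certificate -/

/-- THE θ-CERTIFICATE OF E5M2²→bfloat16 (RNE, sequential): letters `piE5M2`, states `SG`, potential
`psiG`, `θ = 439100963668623365/36028797018963968`, `ρ = 29/6`, `β_pair = 33/2`,
`κ = 36028797018963968/439100963668623365`.
[cell certificate, kernel-checked; gemm.tex §Regimes Prop. Θ(i)] -/
theorem thetaCert_E5M2_BFloat16 :
    ThetaCertificate Format.BFloat16 (fun q => q ∈ piE5M2) SG psiG
      (439100963668623365 / 36028797018963968) (29 / 6) (33 / 2)
      (36028797018963968 / 439100963668623365) where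
  θ_pos := by norm_num
  ρ_nonneg := by norm_num
  βp_nonneg := by norm_num
  κ_nonneg := by norm_num
  start := by
    intro q hq
    obtain ⟨Q, hQ, rfl⟩ := exists_of_mem_piE5M2 hq
    have hb : Q.natAbs < 2 ^ 120 := by have := natAbs_le_of_mem_lamG hQ; norm_num; omega
    have hs := List.all_eq_true.mp starts_all.1 Q hQ
    unfold startOK at hs
    simp only [Bool.and_eq_true, decide_eq_true_eq] at hs
    obtain ⟨⟨⟨⟨h0, h1⟩, h2⟩, h3⟩, -⟩ := hs
    refine ⟨?_, SG_of_idx h1 h2, ?_⟩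
    · obtain ⟨y, hy⟩ := exists_toRat_eq_rne8_dyadic120 g32 Q hb
      exact ⟨y, by rw [hy, h0]⟩
    · rw [psiG_dyadic, abs_div, abs_of_pos (by positivity : (0 : ℚ) < 2 ^ 32), ← Int.cast_abs,
        ← Int.natCast_natAbs]
      have : ((psiZ Q : ℤ) : ℚ) ≤ ((Q.natAbs : ℤ) : ℚ) := by exact_mod_cast h3
      exact div_le_div_of_nonneg_right (by exact_mod_cast this) (by positivity)
  closed := by
    rintro v q ⟨σ, i, hi, rfl⟩ hq
    obtain ⟨Q, hQ, rfl⟩ := exists_of_mem_piE5M2 hq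
    rw [flStep_dyadic120 g32 (hb120 σ i hQ)]
    obtain ⟨τ, j, hj, hW⟩ := isSt_WQ hQ σ i
    unfold WQ at hW
    exact ⟨τ, j, hj, by rw [hW]⟩
  potential := by
    rintro v q ⟨σ, i, hi, rfl⟩ hq hne
    obtain ⟨Q, hQ, rfl⟩ := exists_of_mem_piE5M2 hq
    have hb := hb120 σ i hQ
    rw [flStep_dyadic120 g32 hb] at hne ⊢
    rw [psiG_dyadic, psiG_dyadic, deficitOf_dyadic120 g32 hb]
    have hne' : WQ σ i Q ≠ sval σ i := fun h => hne (by unfold WQ at h; rw [h])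
    obtain ⟨h3, -⟩ := (edge_facts σ hi hQ).2 hne'
    unfold defQ gainQ WQ at h3
    have h3' : ((psiZ (rne8 (sval σ i + Q)) : ℤ) : ℚ)
        ≤ ((psiZ (sval σ i) + ((Q.natAbs : ℤ) - (rne8 (sval σ i + Q) - sval σ i - Q)) : ℤ) : ℚ) := by
      exact_mod_cast h3
    push_cast at h3' ⊢
    linarith
  capacity := by
    rintro v q ⟨σ, i, hi, rfl⟩ hq habs hneg
    obtain ⟨Q, hQ, rfl⟩ := exists_of_mem_piE5M2 hq
    have hb := hb120 σ i hQ
    rw [flStep_dyadic120 g32 hb, dyadic_eq_iff] at habs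
    have hQ0 : Q < 0 := by
      have : (Q : ℚ) < 0 := by
        have h2 : (0 : ℚ) < 2 ^ 32 := by positivity
        by_contra hc; push Not at hc
        exact absurd hneg (not_lt.mpr (div_nonneg hc h2.le))
      exact_mod_cast this
    rw [psiG_dyadic]
    have h := (edge_facts σ hi hQ).1 habs hQ0
    have h' : ((439100963668623365 * -Q : ℤ) : ℚ) ≤ ((36028797018963968 * psiZ (sval σ i) : ℤ) : ℚ) := by
      exact_mod_cast h
    push_cast at h'
    rw [show (439100963668623365 : ℚ) / 36028797018963968 * -((Q : ℚ) / 2 ^ 32)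
        = 439100963668623365 * -(Q : ℚ) / 36028797018963968 / 2 ^ 32 by ring]
    exact div_le_div_of_nonneg_right (by linarith) (by positivity)
  paid := by
    rintro v q ⟨σ, i, hi, rfl⟩ hq hne hpos
    obtain ⟨Q, hQ, rfl⟩ := exists_of_mem_piE5M2 hq
    have hb := hb120 σ i hQ
    have h232 : (0 : ℚ) < 2 ^ 32 := by positivity
    rw [flStep_dyadic120 g32 hb] at hne
    rw [deficitOf_dyadic120 g32 hb] at hpos ⊢
    rw [gainOf_dyadic120 g32 hb]
    have hne' : WQ σ i Q ≠ sval σ i := fun h => hne (by unfold WQ at h; rw [h])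
    have hpos' : 0 < defQ σ i Q := by
      have : (0 : ℚ) < (((Q.natAbs : ℤ) - (rne8 (sval σ i + Q) - sval σ i - Q) : ℤ) : ℚ) := by
        by_contra hc; push Not at hc
        exact absurd hpos (not_lt.mpr (div_nonpos_of_nonpos_of_nonneg hc h232.le))
      unfold defQ gainQ WQ
      exact_mod_cast this
    obtain ⟨-, hmv⟩ := (edge_facts σ hi hQ).2 hne'
    rcases hmv with ⟨-, h⟩ | ⟨hd, -, -⟩
    · unfold defQ gainQ WQ at h
      have h' : ((6 * (rne8 (sval σ i + Q) - sval σ i - Q) : ℤ) : ℚ)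
          ≤ ((29 * ((Q.natAbs : ℤ) - (rne8 (sval σ i + Q) - sval σ i - Q)) : ℤ) : ℚ) := by
        exact_mod_cast h
      push_cast at h' ⊢
      rw [← mul_div_assoc, div_le_div_iff_of_pos_right h232]
      linarith
    · exact absurd hpos' hd
  free := by
    rintro v q ⟨σ, i, hi, rfl⟩ hq hne hd0
    obtain ⟨Q, hQ, rfl⟩ := exists_of_mem_piE5M2 hq
    have hb := hb120 σ i hQ
    have h232 : (0 : ℚ) < 2 ^ 32 := by positivity
    rw [flStep_dyadic120 g32 hb] at hne ⊢
    rw [deficitOf_dyadic120 g32 hb] at hd0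
    rw [gainOf_dyadic120 g32 hb, psiG_dyadic]
    have hne' : WQ σ i Q ≠ sval σ i := fun h => hne (by unfold WQ at h; rw [h])
    have hd0' : defQ σ i Q = 0 := by
      have : ((((Q.natAbs : ℤ) - (rne8 (sval σ i + Q) - sval σ i - Q)) : ℤ) : ℚ) = 0 := by
        rcases div_eq_zero_iff.mp hd0 with h | h
        · exact h
        · exact absurd h (ne_of_gt h232)
      unfold defQ gainQ WQ
      exact_mod_cast this
    obtain ⟨-, hmv⟩ := (edge_facts σ hi hQ).2 hne'
    rcases hmv with ⟨hd, -⟩ | ⟨-, hκ, haux⟩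
    · rw [hd0'] at hd; exact absurd hd (lt_irrefl 0)
    obtain ⟨τ, j, hj, hW, hδ⟩ := freeAux_sound haux
    refine ⟨?_, ?_⟩
    · unfold gainQ WQ at hκ
      have h' : ((439100963668623365 * (rne8 (sval σ i + Q) - sval σ i - Q) : ℤ) : ℚ)
          ≤ ((36028797018963968 * psiZ (sval σ i) : ℤ) : ℚ) := by exact_mod_cast hκ
      push_cast at h' ⊢
      rw [← mul_div_assoc, div_le_div_iff_of_pos_right h232]
      linarith
    · intro q' hq' hne2
      obtain ⟨Q', hQ', rfl⟩ := exists_of_mem_piE5M2 hq'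
      have hWZ : rne8 (sval σ i + Q) = sval τ j := hW
      rw [hWZ] at hne2 ⊢
      have hb' := hb120 τ j hQ'
      rw [flStep_dyadic120 g32 hb'] at hne2
      rw [gainOf_dyadic120 g32 hb', deficitOf_dyadic120 g32 hb']
      have hne2' : WQ τ j Q' ≠ sval τ j := fun h => hne2 (by unfold WQ at h; rw [h])
      have hd' := second_move_paid σ hi hQ hQ' hne' hd0' hW hne2'
      obtain ⟨-, hmv'⟩ := (edge_facts τ hj hQ').2 hne2'
      rcases hmv' with ⟨-, hpaid'⟩ | ⟨hnd, -, -⟩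
      · have key := free_pair_bound hj hδ hne2' hpaid'
        unfold defQ gainQ WQ at key
        rw [hWZ] at key
        have h' : ((2 * ((sval τ j - sval σ i - Q) + (rne8 (sval τ j + Q') - sval τ j - Q')) : ℤ) : ℚ)
            ≤ ((33 * ((Q'.natAbs : ℤ) - (rne8 (sval τ j + Q') - sval τ j - Q')) - 2 : ℤ) : ℚ) := by
          exact_mod_cast key
        push_cast at h' ⊢
        rw [← add_div, ← mul_div_assoc, div_le_div_iff_of_pos_right h232]
        linarith
      · exact absurd hd' hnd

end MiniFloat

end Literature.ComputerArithmetic.FloatingPoint
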